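import Literature.NumberTheory.LFunctions.RobinSquarefreeOdd
import Literature.NumberTheory.LFunctions.RHClassicalEquivalentsRobinProofs
import Literature.NumberTheory.LFunctions.RobinTFreeReduction
import Mathlib.Tactic.IntervalCases
import HarnessLib

/-!
# RH-EQUIVALENT — the Choie–Lichiardopol–Moree–Solé variants of Robin's criterion (CLMS 2007, Thms 1.3, 1.5, 1.6)

RH-EQUIVALENT (statements `RiemannHypothesis ↔ …`); nothing here bears on the truth of RH.
Literature-typing tranche 1 (Broughan, *Equivalents of the Riemann Hypothesis* vol. 1, Ch. 7
"Robin's theorem", the CLMS refinements).  Robin's criterion is `RH ⟺ σ(n) < e^γ n log log n` for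
all `n > 5040` (tree: `robin_iff`, `robin_iff_holds`); CLMS 2007 prove Robin's inequality
unconditionally for squarefree `n ∉ {1,2,3,5,6,10,30}` (Thm 1.1, tree:
`robinInequality_of_squarefree`) and odd `n ∉ {1,3,5,9}` (Thm 1.2, tree: `robinInequality_of_odd`),
whence:

* **CLMS Thm 1.3, PROVED**: "The RH is true if and only if for all even non-squarefree integers
  `≥ 5044` Robin's inequality is satisfied" — `riemannHypothesis_iff_robin_even_nonSquarefree_of`
  (kernel-grade, from `robin_iff`) and `riemannHypothesis_iff_robin_even_nonSquarefree`
  (unconditional, via `robin_iff_holds`); the reduction `robinInequality_of_even_nonSquarefree`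
  disposes of `5041, 5043` (odd) and `5042 = 2 · 2521` (squarefree).
* NAMED FACT **CLMS Thm 1.5**: every `5`-free integer `n > 5040` satisfies Robin's inequality
  (`CLMS2007_thm1_5`; proof in print: Hardy–Ramanujan integers and a MAPLE computation, §6).
* **The "observation" of CLMS §1, PROVED by a certified computation**: every `n ≤ 5040` divisible by
  the fifth power of a prime satisfies Robin's inequality (`robinInequality_of_prime_pow_five_dvd`;
  the `178` such `n` are the multiples of `32`, of `243`, and `3125`), using the tree's Robin
  certificate checker `RobinCheck.check` (`RobinNumerical.lean`) on multiples (`RobinCheck.checkDvd`)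
  with seven `log log` breakpoints.
* **CLMS Thm 1.6, PROVED from `CLMS2007_thm1_5`**: "The RH holds iff for all integers `n` divisible
  by the fifth power of some prime we have `σ(n) < e^γ n log log n`" —
  `riemannHypothesis_iff_robin_of_prime_pow_five_dvd_of` / `…_dvd`.

## References

* Y. Choie, N. Lichiardopol, P. Moree, P. Solé, *On Robin's criterion for the Riemann hypothesis*,
  J. Théor. Nombres Bordeaux 19 (2007) 357–372 (arXiv:math/0604314, read: Thms 3, 5, 6 of the
  arXiv numbering = Thms 1.3, 1.5, 1.6). [CLMS2007]
* G. Robin, *Grandes valeurs de la fonction somme des diviseurs et hypothèse de Riemann*, J. Math.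
  Pures Appl. 63 (1984) 187–213, Thm. 1. [Robin1984]
* K. Broughan, *Equivalents of the Riemann Hypothesis. Vol. 1*, CUP 2017, Ch. 7 (pp. 165–199).
  [Broughan2017Arithmetic] (not held)
-/

noncomputable section

open Real Finset
open scoped ArithmeticFunction.sigma

namespace Literature.NumberTheory.LFunctions

/-! ### CLMS Thm 1.3: even non-squarefree integers `≥ 5044` -/

/-- The reduction behind CLMS Thm 1.3: if Robin's inequality holds for every even non-squarefree
`n ≥ 5044`, it holds for every `n > 5040` — odd `n` by CLMS Thm 1.2, squarefree `n` by CLMS Thm 1.1,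
and `5042 = 2 · 2521` is squarefree. [cite: CLMS2007, Thm 1.3 (proof)] -/
theorem robinInequality_of_even_nonSquarefree
    (h : ∀ n : ℕ, 5044 ≤ n → Even n → ¬ Squarefree n → robinInequality n) {n : ℕ}
    (hn : 5040 < n) : robinInequality n := by
  rcases Nat.even_or_odd n with he | ho
  · by_cases hsq : Squarefree n
    · exact robinInequality_of_squarefree_of_gt hsq (by omega)
    · refine h n ?_ he hsq
      by_contra hlt
      push Not at hlt
      interval_cases n
      · exact absurd he (by decide)
      · have h' : Squarefree (2 * 2521) := Nat.squarefree_mul_iff.2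
          ⟨by norm_num, Nat.prime_two.prime.squarefree, (by norm_num : Nat.Prime 2521).prime.squarefree⟩
        exact hsq (by simpa using h')
      · exact absurd he (by decide)
  · exact robinInequality_of_odd ho (by simp only [Finset.mem_insert, Finset.mem_singleton]; omega)

/-- **CLMS 2007, Thm 1.3 (kernel-grade form, PROVED from Robin's criterion `robin_iff`)**: "The RH is
true if and only if for all even non-squarefree integers `≥ 5044` Robin's inequality is satisfied."
[cite: CLMS2007, Thm 1.3; Broughan2017Arithmetic, Ch. 7 (pp. 165–199)] -/
theorem riemannHypothesis_iff_robin_even_nonSquarefree_of (hR : robin_iff) :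
    RiemannHypothesis ↔ ∀ n : ℕ, 5044 ≤ n → Even n → ¬ Squarefree n → robinInequality n := by
  rw [robin_iff_iff.1 hR]
  exact ⟨fun h n hn _ _ => h n (by omega),
    fun h n hn => robinInequality_of_even_nonSquarefree h hn⟩

/-- **CLMS 2007, Thm 1.3 (PROVED)**: RH iff every even non-squarefree `n ≥ 5044` satisfies
`σ(n) < e^γ n log log n` (via the tree's `robin_iff_holds`; closure `computational`).
[cite: CLMS2007, Thm 1.3] -/
theorem riemannHypothesis_iff_robin_even_nonSquarefree :
    RiemannHypothesis ↔ ∀ n : ℕ, 5044 ≤ n → Even n → ¬ Squarefree n → robinInequality n :=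
  riemannHypothesis_iff_robin_even_nonSquarefree_of robin_iff_holds

/-! ### CLMS Thm 1.5 (NAMED FACT) -/

/-- NAMED FACT **CLMS 2007, Thm 1.5**: every `5`-free integer `n > 5040` (`p⁵ ∤ n` for all primes `p`,
tree: `TFree 5 n`) satisfies Robin's inequality. (Printed as "All 5-free integers satisfy Robin's
inequality" for the integers in the range of Robin's criterion; the `26` exceptions `≤ 5040` are all
`5`-free.) Proof in print: the least `t`-free counterexample is a Hardy–Ramanujan integer with
`P(n) < log n` (Lemmas 11–15) and a MAPLE enumeration of the `12649` `5`-free Hardy–Ramanujan integers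
with `P(n) ≤ 73`. Users take `(h : CLMS2007_thm1_5)`. [cite: CLMS2007, Thm 1.5 and §6] -/
def CLMS2007_thm1_5 : Prop :=
  ∀ n : ℕ, 5040 < n → TFree 5 n → robinInequality n

/-! ### The observation "all exceptions `≤ 5040` are `5`-free", by certified computation -/

namespace RobinCheck

/-- The Robin certificate `check num den` on the multiples of `m` in `[lo, lo + len)`. [cite: CLMS2007, §1] -/
def checkDvd (m num den lo : ℕ) : ℕ → Bool
  | 0 => true
  | len + 1 => (bif ((lo + len) % m).beq 0 then check num den (lo + len) else true) &&
      checkDvd m num den lo len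

/-- Soundness of `checkDvd`: every multiple of `m` in the range passes `check`. [cite: CLMS2007, §1] -/
theorem checkDvd_sound {m num den lo : ℕ} :
    ∀ {len : ℕ}, checkDvd m num den lo len = true →
      ∀ n, lo ≤ n → n < lo + len → m ∣ n → check num den n = true
  | 0, _, n, h1, h2, _ => by omega
  | len + 1, h, n, h1, h2, hm => by
    rw [checkDvd, Bool.and_eq_true] at h
    by_cases hn : n = lo + len
    · subst hn
      have hmod : (lo + len) % m = 0 := Nat.mod_eq_zero_of_dvd hm
      have hb : ((lo + len) % m).beq 0 = true := by rw [hmod]; rfl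
      have h1' := h.1
      rw [hb] at h1'
      exact h1'
    · exact checkDvd_sound h.2 n h1 (by omega) hm

/-- A checked range of multiples of `m` with breakpoint `b ≤ lo` and `L ≤ log log b` satisfies
Robin's inequality at every multiple of `m` in `[lo, lo + len)` (cf. `robin_range`). [cite: CLMS2007, §1] -/
theorem robin_dvd_range (m num lo len : ℕ) {b L : ℝ} (hc : checkDvd m num 10000 lo len = true)
    (hb1 : 1 < b) (hblo : b ≤ lo) (hL : L ≤ log (log b)) (hLpos : 0 < L)
    (hT : (num : ℝ) ≤ 1.7802 * L * 10000) (hhi : lo + len ≤ 83521) :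
    ∀ n : ℕ, lo ≤ n → n < lo + len → m ∣ n → robinInequality n := by
  intro n h1 h2 hm
  have hchk := checkDvd_sound hc n h1 h2 hm
  have hlo' : (lo : ℝ) ≤ n := by exact_mod_cast h1
  have hlo0 : 0 < lo := by exact_mod_cast (show (0 : ℝ) < lo by linarith)
  exact robinInequality_of_bound hb1 (hblo.trans hlo') hL hLpos hT (by norm_num)
    (check_sound (by omega) (by omega) hchk)

/-- Certificate (kernel `decide`). [folklore] -/
private theorem checkDvd_32_32 : checkDvd 32 22126 10000 32 64 = true := by decide +kernel
/-- Certificate (kernel `decide`). [folklore] -/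
private theorem checkDvd_32_96 : checkDvd 32 27026 10000 96 192 = true := by decide +kernel
/-- Certificate (kernel `decide`). [folklore] -/
private theorem checkDvd_32_288 : checkDvd 32 30866 10000 288 192 = true := by decide +kernel
/-- Certificate (kernel `decide`). [folklore] -/
private theorem checkDvd_32_480 : checkDvd 32 32403 10000 480 480 = true := by decide +kernel
/-- Certificate (kernel `decide`). [folklore] -/
private theorem checkDvd_32_960 : checkDvd 32 34297 10000 960 480 = true := by decide +kernel
/-- Certificate (kernel `decide`). [folklore] -/
private theorem checkDvd_32_1440 : checkDvd 32 35319 10000 1440 1440 = true := by decide +kernel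
/-- Certificate (kernel `decide`). [folklore] -/
private theorem checkDvd_32_2880 : checkDvd 32 36940 10000 2880 2161 = true := by decide +kernel
/-- Certificate (kernel `decide`). [folklore] -/
private theorem checkDvd_243_243 : checkDvd 243 27026 10000 243 729 = true := by decide +kernel
/-- Certificate (kernel `decide`). [folklore] -/
private theorem checkDvd_243_972 : checkDvd 243 34297 10000 972 4069 = true := by decide +kernel
/-- Certificate (kernel `decide`). [folklore] -/
private theorem checkDvd_3125 : checkDvd 3125 36940 10000 3125 1 = true := by decide +kernel

/-! #### `log log` breakpoints `32, 96, 288, 480, 960, 1440, 2880` (as in `loglog_5000`) -/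

/-- `1.2429 ≤ log log 32`. [folklore] -/
private theorem loglog_32 : (1.2429 : ℝ) ≤ log (log 32) := by
  refine le_loglog_of_exp_le (ℓ := 3.4657359015) ?_ ?_
  · rw [show (32 : ℝ) = 2 ^ 5 by norm_num, Real.log_pow]
    have := Real.log_two_gt_d9
    push_cast; linarith
  · have h := exp_three_mul_le (x := 1.2429 / 3) (by norm_num) (by norm_num)
    rw [show (3 : ℝ) * (1.2429 / 3) = 1.2429 by ring] at h
    refine h.trans ?_
    simp only [Finset.sum_range_succ, Finset.sum_range_zero, Nat.factorial]
    norm_num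

/-- `1.5182 ≤ log log 96`. [folklore] -/
private theorem loglog_96 : (1.5182 : ℝ) ≤ log (log 96) := by
  refine le_loglog_of_exp_le (ℓ := 4.5643481900) ?_ ?_
  · rw [show (96 : ℝ) = 2 ^ 5 * 3 by norm_num, Real.log_mul (by norm_num) (by norm_num),
      Real.log_pow]
    have := Real.log_two_gt_d9; have := Real.log_three_gt_d9
    push_cast; linarith
  · have h := exp_three_mul_le (x := 1.5182 / 3) (by norm_num) (by norm_num)
    rw [show (3 : ℝ) * (1.5182 / 3) = 1.5182 by ring] at h
    refine h.trans ?_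
    simp only [Finset.sum_range_succ, Finset.sum_range_zero, Nat.factorial]
    norm_num

/-- `1.7339 ≤ log log 288`. [folklore] -/
private theorem loglog_288 : (1.7339 : ℝ) ≤ log (log 288) := by
  refine le_loglog_of_exp_le (ℓ := 5.6629604785) ?_ ?_
  · rw [show (288 : ℝ) = 2 ^ 5 * 3 ^ 2 by norm_num, Real.log_mul (by norm_num) (by norm_num),
      Real.log_pow, Real.log_pow]
    have := Real.log_two_gt_d9; have := Real.log_three_gt_d9
    push_cast; linarith
  · have h := exp_three_mul_le (x := 1.7339 / 3) (by norm_num) (by norm_num)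
    rw [show (3 : ℝ) * (1.7339 / 3) = 1.7339 by ring] at h
    refine h.trans ?_
    simp only [Finset.sum_range_succ, Finset.sum_range_zero, Nat.factorial]
    norm_num

/-- `1.8202 ≤ log log 480`. [folklore] -/
private theorem loglog_480 : (1.8202 : ℝ) ≤ log (log 480) := by
  refine le_loglog_of_exp_le (ℓ := 6.1737861023) ?_ ?_
  · rw [show (480 : ℝ) = 2 ^ 5 * 3 * 5 by norm_num, Real.log_mul (by norm_num) (by norm_num),
      Real.log_mul (by norm_num) (by norm_num), Real.log_pow]
    have := Real.log_two_gt_d9; have := Real.log_three_gt_d9; have := Real.log_five_gt_d9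
    push_cast; linarith
  · have h := exp_three_mul_le (x := 1.8202 / 3) (by norm_num) (by norm_num)
    rw [show (3 : ℝ) * (1.8202 / 3) = 1.8202 by ring] at h
    refine h.trans ?_
    simp only [Finset.sum_range_succ, Finset.sum_range_zero, Nat.factorial]
    norm_num

/-- `1.9266 ≤ log log 960`. [folklore] -/
private theorem loglog_960 : (1.9266 : ℝ) ≤ log (log 960) := by
  refine le_loglog_of_exp_le (ℓ := 6.8669332826) ?_ ?_
  · rw [show (960 : ℝ) = 2 ^ 6 * 3 * 5 by norm_num, Real.log_mul (by norm_num) (by norm_num),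
      Real.log_mul (by norm_num) (by norm_num), Real.log_pow]
    have := Real.log_two_gt_d9; have := Real.log_three_gt_d9; have := Real.log_five_gt_d9
    push_cast; linarith
  · have h := exp_three_mul_le (x := 1.9266 / 3) (by norm_num) (by norm_num)
    rw [show (3 : ℝ) * (1.9266 / 3) = 1.9266 by ring] at h
    refine h.trans ?_
    simp only [Finset.sum_range_succ, Finset.sum_range_zero, Nat.factorial]
    norm_num

/-- `1.9840 ≤ log log 1440`. [folklore] -/
private theorem loglog_1440 : (1.9840 : ℝ) ≤ log (log 1440) := by
  refine le_loglog_of_exp_le (ℓ := 7.2723983908) ?_ ?_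
  · rw [show (1440 : ℝ) = 2 ^ 5 * 3 ^ 2 * 5 by norm_num, Real.log_mul (by norm_num) (by norm_num),
      Real.log_mul (by norm_num) (by norm_num), Real.log_pow, Real.log_pow]
    have := Real.log_two_gt_d9; have := Real.log_three_gt_d9; have := Real.log_five_gt_d9
    push_cast; linarith
  · have h := exp_three_mul_le (x := 1.9840 / 3) (by norm_num) (by norm_num)
    rw [show (3 : ℝ) * (1.9840 / 3) = 1.9840 by ring] at h
    refine h.trans ?_
    simp only [Finset.sum_range_succ, Finset.sum_range_zero, Nat.factorial]
    norm_num

/-- `2.0751 ≤ log log 2880`. [folklore] -/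
private theorem loglog_2880 : (2.0751 : ℝ) ≤ log (log 2880) := by
  refine le_loglog_of_exp_le (ℓ := 7.9655455711) ?_ ?_
  · rw [show (2880 : ℝ) = 2 ^ 6 * 3 ^ 2 * 5 by norm_num, Real.log_mul (by norm_num) (by norm_num),
      Real.log_mul (by norm_num) (by norm_num), Real.log_pow, Real.log_pow]
    have := Real.log_two_gt_d9; have := Real.log_three_gt_d9; have := Real.log_five_gt_d9
    push_cast; linarith
  · have h := exp_three_mul_le (x := 2.0751 / 3) (by norm_num) (by norm_num)
    rw [show (3 : ℝ) * (2.0751 / 3) = 2.0751 by ring] at h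
    refine h.trans ?_
    simp only [Finset.sum_range_succ, Finset.sum_range_zero, Nat.factorial]
    norm_num

/-- Robin's inequality at every multiple of `32` in `[32, 5041)`. [cite: CLMS2007, §1] -/
theorem robinInequality_of_32_dvd {n : ℕ} (h32 : 32 ∣ n) (hlo : 32 ≤ n) (hhi : n ≤ 5040) :
    robinInequality n := by
  by_cases h1 : n < 96
  · exact robin_dvd_range 32 22126 32 64 checkDvd_32_32 (b := 32) (by norm_num) (by norm_num)
      loglog_32 (by norm_num) (by norm_num) (by norm_num) n hlo (by omega) h32
  by_cases h2 : n < 288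
  · exact robin_dvd_range 32 27026 96 192 checkDvd_32_96 (b := 96) (by norm_num) (by norm_num)
      loglog_96 (by norm_num) (by norm_num) (by norm_num) n (by omega) (by omega) h32
  by_cases h3 : n < 480
  · exact robin_dvd_range 32 30866 288 192 checkDvd_32_288 (b := 288) (by norm_num) (by norm_num)
      loglog_288 (by norm_num) (by norm_num) (by norm_num) n (by omega) (by omega) h32
  by_cases h4 : n < 960
  · exact robin_dvd_range 32 32403 480 480 checkDvd_32_480 (b := 480) (by norm_num) (by norm_num)
      loglog_480 (by norm_num) (by norm_num) (by norm_num) n (by omega) (by omega) h32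
  by_cases h5 : n < 1440
  · exact robin_dvd_range 32 34297 960 480 checkDvd_32_960 (b := 960) (by norm_num) (by norm_num)
      loglog_960 (by norm_num) (by norm_num) (by norm_num) n (by omega) (by omega) h32
  by_cases h6 : n < 2880
  · exact robin_dvd_range 32 35319 1440 1440 checkDvd_32_1440 (b := 1440) (by norm_num)
      (by norm_num) loglog_1440 (by norm_num) (by norm_num) (by norm_num) n (by omega) (by omega) h32
  exact robin_dvd_range 32 36940 2880 2161 checkDvd_32_2880 (b := 2880) (by norm_num) (by norm_num)
    loglog_2880 (by norm_num) (by norm_num) (by norm_num) n (by omega) (by omega) h32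

/-- Robin's inequality at every multiple of `243` in `[243, 5041)`. [cite: CLMS2007, §1] -/
theorem robinInequality_of_243_dvd {n : ℕ} (h243 : 243 ∣ n) (hlo : 243 ≤ n) (hhi : n ≤ 5040) :
    robinInequality n := by
  by_cases h1 : n < 972
  · exact robin_dvd_range 243 27026 243 729 checkDvd_243_243 (b := 96) (by norm_num) (by norm_num)
      loglog_96 (by norm_num) (by norm_num) (by norm_num) n hlo (by omega) h243
  exact robin_dvd_range 243 34297 972 4069 checkDvd_243_972 (b := 960) (by norm_num) (by norm_num)
    loglog_960 (by norm_num) (by norm_num) (by norm_num) n (by omega) (by omega) h243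

/-- Robin's inequality at `3125 = 5⁵`. [cite: CLMS2007, §1] -/
theorem robinInequality_3125 : robinInequality 3125 :=
  robin_dvd_range 3125 36940 3125 1 checkDvd_3125 (b := 2880) (by norm_num) (by norm_num)
    loglog_2880 (by norm_num) (by norm_num) (by norm_num) 3125 le_rfl (by norm_num) (dvd_refl _)

end RobinCheck

open RobinCheck in
/-- **CLMS's observation "all exceptions `≤ 5040` to Robin's inequality are `5`-free", PROVED**
(certified computation): every `1 ≤ n ≤ 5040` divisible by the fifth power of a prime satisfies
`σ(n) < e^γ n log log n`. [cite: CLMS2007, §1 (before Thm 1.6)] -/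
theorem robinInequality_of_prime_pow_five_dvd {n p : ℕ} (hp : p.Prime) (hdvd : p ^ 5 ∣ n)
    (hn0 : 0 < n) (hn : n ≤ 5040) : robinInequality n := by
  have hle : p ^ 5 ≤ n := Nat.le_of_dvd hn0 hdvd
  have hp2 := hp.two_le
  have hp7 : p < 7 := by
    by_contra h
    push Not at h
    have : 7 ^ 5 ≤ p ^ 5 := Nat.pow_le_pow_left h 5
    omega
  interval_cases p
  · exact robinInequality_of_32_dvd (by simpa using hdvd) (by simpa using hle) hn
  · exact robinInequality_of_243_dvd (by simpa using hdvd) (by simpa using hle) hn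
  · exact absurd hp (by decide)
  · have h3125 : 3125 ∣ n := by simpa using hdvd
    obtain ⟨k, rfl⟩ := h3125
    obtain rfl : k = 1 := by omega
    exact robinInequality_3125
  · exact absurd hp (by decide)

/-! ### CLMS Thm 1.6 -/

/-- **CLMS 2007, Thm 1.6 (kernel-grade form, PROVED from `robin_iff` and `CLMS2007_thm1_5`)**:
"The RH holds iff for all integers `n` divisible by the fifth power of some prime we have
`σ(n) < e^γ n log log n`" (`n ≥ 1`). The range `n ≤ 5040` of the `⟹` direction is
`robinInequality_of_prime_pow_five_dvd`. [cite: CLMS2007, Thm 1.6] -/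
theorem riemannHypothesis_iff_robin_of_prime_pow_five_dvd_of (hR : robin_iff)
    (h5 : CLMS2007_thm1_5) :
    RiemannHypothesis ↔
      ∀ n : ℕ, 0 < n → (∃ p : ℕ, p.Prime ∧ p ^ 5 ∣ n) → robinInequality n := by
  rw [robin_iff_iff.1 hR]
  refine ⟨fun h n hn0 ⟨p, hp, hdvd⟩ => ?_, fun h n hn => ?_⟩
  · by_cases hbig : 5040 < n
    · exact h n hbig
    · exact robinInequality_of_prime_pow_five_dvd hp hdvd hn0 (by omega)
  · by_cases htf : TFree 5 n
    · exact h5 n hn htf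
    · unfold TFree at htf
      push Not at htf
      obtain ⟨p, hp, hdvd⟩ := htf
      exact h n (by omega) ⟨p, hp, hdvd⟩

/-- **CLMS 2007, Thm 1.6 (PROVED from `CLMS2007_thm1_5`)**, unconditional form via the tree's
`robin_iff_holds` (closure `computational`). [cite: CLMS2007, Thm 1.6] -/
theorem riemannHypothesis_iff_robin_of_prime_pow_five_dvd (h5 : CLMS2007_thm1_5) :
    RiemannHypothesis ↔
      ∀ n : ℕ, 0 < n → (∃ p : ℕ, p.Prime ∧ p ^ 5 ∣ n) → robinInequality n :=
  riemannHypothesis_iff_robin_of_prime_pow_five_dvd_of robin_iff_holds h5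

end Literature.NumberTheory.LFunctions

end
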